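import Summits.ResolutionOfSingularities.ResolutionOfSingularities.Theorems.EquisingularLiftEquisingularLiftNatTowerBQuadPrimeAssembly
import Summits.ResolutionOfSingularities.ResolutionOfSingularities.Theorems.EquisingularLiftEquisingularLiftNatTowerBDoublePrimeSAssemblyFull
import Summits.ResolutionOfSingularities.ResolutionOfSingularities.Theorems.EquisingularLiftEquisingularLiftNatInvSLStepRegular
import Summits.ResolutionOfSingularities.ResolutionOfSingularities.Theorems.EquisingularLiftEquisingularLiftNatInvSLStepSingular
import Summits.ResolutionOfSingularities.ResolutionOfSingularities.Theorems.EquisingularLiftEquisingularLiftNatTowerCurveStepBSL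
import Summits.ResolutionOfSingularities.ResolutionOfSingularities.Theorems.EquisingularLiftEquisingularLiftNatInvSZeroLStepRegular
import Summits.ResolutionOfSingularities.ResolutionOfSingularities.Theorems.EquisingularLiftEquisingularLiftNatInvSZeroLStepSingular
import Summits.ResolutionOfSingularities.ResolutionOfSingularities.Theorems.EquisingularLiftEquisingularLiftNatTowerCurveStepBSZeroL
import Summits.ResolutionOfSingularities.ResolutionOfSingularities.Theorems.EquisingularLiftEquisingularLiftNatTCPlusInvBaseSZeroL
import Summits.ResolutionOfSingularities.ResolutionOfSingularities.Theorems.EquisingularLiftEquisingularLiftNatExactShadowPlanar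
import HarnessLib

/-!
# [OURS · L1 W4.5(b) · EL♮(3) · T23-A⁗] HSUB⁵ WITH LETTERS, (U6) STEP/CURVE BRICKS DISCHARGED (V10⁵-full) = V10⁗-full (p631707) with the letter seed `Ls₂` threaded
# = `hsub_reachTowerBQuadPrime_of_fact` (…NatTowerBQuadPrimeAssembly) ∘ (`TCPlus.InvSL` / `TCPlus.InvS₀L` steps and curve steps); inputs left: (T-k) `hFact`,
# the letter bookkeeping `hLs₂`, and the TWO seed bricks `hBaseSL` / `hBaseS₀L` over `Ls₂` (res-type-027's (L3) letter seeds, discharged in the rung⁵)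

res-L1-w45b-stub-4 g11 (A-engine owner; engine word v2 FINAL 81913c484db62a21, desk DEAL/R30). OURS; NOT a statement of any manuscript ([Hironaka2017] is a
candidate under adjudication, nothing of it is asserted); AI-written, weaker than expert review. No `sorry`; standard axioms; DEF-FREE;
`--supports stmt-ResolutionOfSingularities-20148 --as helper`.

WHAT. `INNER W G β T Z K S Ps Ms b := ((K = ∅ ∧ TCPlus.InvS₀L … S Ps b) ∨ (TCPlus.InvSL … K S Ps b ∧ IsClosed K ∧ K ⊆ closure (K ∖ closure Z) ∧ K ≠ univ ∧
IsClosed Z)) ∧ (∀ P ∈ Ps, IsClosed P ∧ ¬ T ⊆ P) ∧ (∀ M ∈ Ms, IsClosed M ∧ ¬ T ⊆ M) ∧ (IsClosed S ∧ S ⊆ closure (S ∖ closure Z) ∧ ¬ T ⊆ S)` (V10‴'s `INVS` + the two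
list-bookkeeping conjuncts); `hInnerInv` by `invSL_invS`/`invS_inv` resp. the shadow-free projections; `hBase` = V10‴'s base block (plane facts: the exceptional
plane is irreducible — `F₁` regular at `x` — and not inside `St_x W`) over the two seed INPUTS `hBaseSL` / `hBaseS₀L` (letters `Ls₂` seeded; bookkeeping `hLs₂`); `hStep`/`hSing` = res-type-027's `invSL_step_regular/_singular`
(p628217/p628882) / `invS₀L_step_*` + the plane-list bookkeeping (new plane: closed, `St T ⊄ υ₁⁻¹{y}` since a point of `T` off `y` lifts; transported members:
`not_closure_preimage_diff_subset`); `hCurve` = `Tower.invB₄_of_invSL_curveStep_FE` (p629286) / `Tower.invB₄_of_invS₀L_curveStep_forget_FE` with the K-side facts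
derived as in V10‴. [cite: GortzWedhorn2020, (13.19) and Prop. 13.91] [cite: Liu2002, Thm. 8.1.19]
-/

set_option linter.dupNamespace false -- mandated namespace `Summit.<Summit>.<Problem>` of this single-conjunct summit
set_option linter.overlappingInstances false -- signatures carry `[IsDomain O] [IsDiscreteValuationRing O]`

noncomputable section

open CategoryTheory CategoryTheory.Limits AlgebraicGeometry TopologicalSpace Topology IsLocalRing
open Literature.AlgebraicGeometry.Resolution
open AlgebraicGeometry.Scheme.IdealSheafData
open Summit.ResolutionOfSingularities.ResolutionOfSingularities.Theses.EquisingularLift.Split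
open Summit.ResolutionOfSingularities.ResolutionOfSingularities.Cruxes.EquisingularLift.StrataSplit

namespace Summit.ResolutionOfSingularities.ResolutionOfSingularities.Cruxes.EquisingularLiftNat.Sections

set_option maxHeartbeats 800000 in
/-- **HSUB⁵ = HSUB⁗ with the LETTER seed `Ls₂` threaded** (module docstring; = p631707 with the two seed bricks as inputs). [OURS · L1 W4.5b · T23-A‴ engine] toward
`stub_elnat_defTowerBTriplePrimePointResolutionThree`; NOT a statement of the manuscript. -/
theorem hsub_reachTowerBQuadPrime_of_fact_full (k : Type) [Field k] [IsAlgClosed k]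
    (O : Type) [CommRing O] [IsDomain O] [IsDiscreteValuationRing O] [IsAdicComplete (IsLocalRing.maximalIdeal O) O]
    [IsAlgClosed (IsLocalRing.ResidueField O)] (θ : O →+* k) (hθ : Function.Surjective θ)
    (P : Scheme.{0}) (q : P ⟶ Spec (.of O)) (Y : Set P) (Ch : ∀ X' : Scheme.{0}, (X' ⟶ P) → Set X' → Prop)
    (hChStep : ∀ (X' X'' : Scheme.{0}) (σ' : X' ⟶ P) (S' : Set X') (C : X'.IdealSheafData) (τ : X'' ⟶ X'),
      Ch X' σ' S' → IsBlowup τ C → Scheme.IsRegular C.subscheme → Flat (C.subschemeι ≫ σ' ≫ q) →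
      σ' '' (C.support : Set X') ⊆ {y | ¬ IsGenericPoint y Y} → (C.support : Set X') ∩ (σ' ≫ q) ⁻¹' {IsLocalRing.closedPoint O} ⊆ S' →
      Ch X'' (τ ≫ σ') (closure (τ ⁻¹' (S' \ (C.support : Set X')))))
    (hChSplit : ∀ (X' : Scheme.{0}) (σ' : X' ⟶ P) (S' : Set X'), Ch X' σ' S' → Chain P Y X' σ' S')
    (hYsp : Y ⊆ q ⁻¹' {IsLocalRing.closedPoint O}) (hYirr : IsIrreducible Y) (hYcl : IsClosed Y) (hPint : IsIntegral P)
    (hPnoeth : IsLocallyNoetherian P) (hPreg : Scheme.IsRegular P) (hqprop : IsProper q) (hqsm : SmoothOfRelativeDimension 3 q)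
    (X' : Scheme.{0}) (σ' : X' ⟶ P) (S' : Set X') (_hCh' : Ch X' σ' S') (_hX'int : IsIntegral X') (_hX'noeth : IsLocallyNoetherian X')
    (_hX'reg : Scheme.IsRegular X') (_hX'dom : IsDominant (σ' ≫ q)) (F₁ : Scheme.{0}) (hF₁ : IsIntegral F₁) (j : F₁ ⟶ X')
    (t : F₁ ⟶ Spec (.of k)) (_hsq : IsPullback j t (σ' ≫ q) (Spec.map (CommRingCat.ofHom θ))) (T₁ : Set F₁) (_hT₁cl : IsClosed T₁)
    (_hT₁irr : IsIrreducible T₁) (_hjT₁ : j '' T₁ = S') (x : F₁) (hx : IsClosed ({x} : Set F₁)) (U : X'.Opens)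
    (_hU : Smooth (U.ι ≫ σ' ≫ q)) (s : Spec (.of O) ⟶ X') (_hs : s ≫ σ' ≫ q = 𝟙 _) (_hsU : s (IsLocalRing.closedPoint O) ∈ U)
    (_hsx : s (IsLocalRing.closedPoint O) = j x)
    (_hdim : ringKrullDim (X'.presheaf.stalk (s (IsLocalRing.closedPoint O))) = ((3 + 1 : ℕ) : WithBot ℕ∞))
    (hxreg : IsRegularLocalRing (F₁.presheaf.stalk x)) (_hsoff : ∀ c ∈ (s.ker.support : Set X'), ¬ IsGenericPoint (σ' c) Y)
    (X₁ : Scheme.{0}) (τ₁ : X₁ ⟶ X') (_hτ₁ : IsBlowup τ₁ s.ker) (_hX₁int : IsIntegral X₁) (_hX₁noeth : IsLocallyNoetherian X₁)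
    (_hX₁reg : Scheme.IsRegular X₁) (_hX₁dom : IsDominant ((τ₁ ≫ σ') ≫ q)) (F₂ : Scheme.{0}) (_hF₂ : IsIntegral F₂) (υ : F₂ ⟶ F₁)
    (hυ : IsBlowup υ (vanishingIdeal (⟨{x}, hx⟩ : Closeds F₁))) (j₂ : F₂ ⟶ X₁) (t₂ : F₂ ⟶ Spec (.of k))
    (_hsq₂ : IsPullback j₂ t₂ ((τ₁ ≫ σ') ≫ q) (Spec.map (CommRingCat.ofHom θ))) (_hcomm : j₂ ≫ τ₁ = υ ≫ j)
    (_hcarrier : (s.ker.comap τ₁).comap j₂ = (vanishingIdeal (⟨{x}, hx⟩ : Closeds F₁)).comap υ)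
    (hirr₂ : IsIrreducible (closure (υ ⁻¹' (T₁ \ {x})))) (_hCh₁ : Ch X₁ (τ₁ ≫ σ') (j₂ '' closure (υ ⁻¹' (T₁ \ {x}))))
    -- the LETTER seed (T23-A⁗): strict transforms at `F₂` of the initial-stage hyperplanes, with their downstairs bookkeeping
    (Ls₂ : List (Set F₂)) (hLs₂ : ∀ L ∈ Ls₂, IsClosed L ∧ ¬ closure (υ ⁻¹' (T₁ \ {x})) ⊆ L)
    -- ===================== THE FACT AND THE NAMED STAND-INS =====================
    -- (T-k) the embedded-curve lift at every stage / exceptional surface over `q` (res-L1-w45b-lead-2 …NatTowerRoundFourDefs p594791)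
    -- ===================== THE FACT AND THE ONE NAMED SEED INPUT =====================
    -- (T-k) the embedded-curve lift at every stage / exceptional surface over `q` (res-L1-w45b-lead-2 …NatTowerRoundFourDefs p594791)
    (hFact : EmbeddedCurveLift O k θ P q)
    -- (SL-base, conical `W`) `TCPlus.InvSL … [] false` at the first point step (res-type-027 `inv_baseSL`, characteristic-dependent; discharged in the rung⁗)
    (hBaseSL : ∀ W : Set F₁, x ∈ W → ¬ (υ ⁻¹' {x} ⊆ closure (υ ⁻¹' (W \ {x}))) →
        (∃ U₁ : F₁.affineOpens, x ∈ (U₁ : F₁.Opens) ∧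
          ((vanishingIdeal (⟨closure W, isClosed_closure⟩ : Closeds F₁)).ideal U₁).IsPrincipal) →
        ConeForm F₁ x W →
        TCPlus.InvSL O k θ P q Y Ch W F₂ (𝟙 F₂) (closure (υ ⁻¹' (T₁ \ {x}))) (υ ⁻¹' {x} ∩ closure (υ ⁻¹' (W \ {x})))
          (closure (υ ⁻¹' (W \ {x}))) (υ ⁻¹' {x}) Ls₂ false)
    -- (S₀L-base) the shadow-free twin with the letters (res-type-027's (L3); with `Ls₂ = []` it is `inv_baseS₀L`, char-free)
    (hBaseS₀L : ∀ W : Set F₁, x ∈ W → ¬ (υ ⁻¹' {x} ⊆ closure (υ ⁻¹' (W \ {x}))) →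
        (∃ U₁ : F₁.affineOpens, x ∈ (U₁ : F₁.Opens) ∧
          ((vanishingIdeal (⟨closure W, isClosed_closure⟩ : Closeds F₁)).ideal U₁).IsPrincipal) →
        TCPlus.InvS₀L O k θ P q Y Ch W F₂ (𝟙 F₂) (closure (υ ⁻¹' (T₁ \ {x}))) (υ ⁻¹' {x} ∩ closure (υ ⁻¹' (W \ {x}))) (υ ⁻¹' {x})
          Ls₂ false) :
    -- ===================== THE CONCLUSION OF HSUB⁗(ReachTowerB‴)₃ =====================
    ∀ (F' : Scheme.{0}) (β : F' ⟶ F₂) (T' : Set F'), ReachTowerBQuadPrime F₁ F₂ υ x (closure (υ ⁻¹' (T₁ \ {x}))) Ls₂ F' β T' →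
      ∃ (X₉ : Scheme.{0}) (σ₉ : X₉ ⟶ P) (S₉ : Set X₉) (j₉ : F' ⟶ X₉) (t₉ : F' ⟶ Spec (.of k)),
        Ch X₉ σ₉ S₉ ∧ IsIntegral X₉ ∧ IsLocallyNoetherian X₉ ∧ Scheme.IsRegular X₉ ∧ IsDominant (σ₉ ≫ q) ∧
        IsPullback j₉ t₉ (σ₉ ≫ q) (Spec.map (CommRingCat.ofHom θ)) ∧ j₉ '' T' = S₉ ∧ IsClosed T' ∧ IsIrreducible T' ∧ IsIntegral F' := by
  classical
  haveI := hPint; haveI := hqprop; haveI := hqsm; haveI := hF₁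
  -- the special fibre of `F₂` over `x`: closed, irreducible, not inside `St_x W`, not containing `St_x T₁`
  have hEx : IsClosed (υ ⁻¹' ({x} : Set F₁)) := hx.preimage υ.continuous
  obtain ⟨y₀, hy₀⟩ := closure_nonempty_iff.mp hirr₂.nonempty
  have hExirr : IsIrreducible (υ ⁻¹' ({x} : Set F₁)) :=
    isIrreducible_preimage_singleton_of_isRegularLocalRing υ hx hxreg hυ ⟨υ y₀, fun h => hy₀.2 h⟩
  have hnoethOfINV := Tower.isLocallyNoetherian_of_innerInv O k θ hθ P q Y Ch (F₁ := F₁) (F₂ := F₂)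
  -- ===================== the inner invariant =====================
  let INNER : Set F₁ → ∀ G : Scheme.{0}, (G ⟶ F₂) → Set G → Set G → Set G → Set G → List (Set G) → List (Set G) → Bool → Prop :=
    fun W G β T Z K S Ps Ms b =>
      ((K = ∅ ∧ TCPlus.InvS₀L O k θ P q Y Ch W G β T Z S Ps b) ∨
        (TCPlus.InvSL O k θ P q Y Ch W G β T Z K S Ps b ∧ IsClosed K ∧ K ⊆ closure (K \ closure Z) ∧ K ≠ Set.univ ∧ IsClosed Z)) ∧
      (∀ P₀ ∈ Ps, IsClosed P₀ ∧ ¬ T ⊆ P₀) ∧ (∀ M ∈ Ms, IsClosed M ∧ ¬ T ⊆ M) ∧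
      (IsClosed S ∧ S ⊆ closure (S \ closure Z) ∧ ¬ T ⊆ S)
  have hINNERinv : ∀ W G β T Z K S Ps Ms b, INNER W G β T Z K S Ps Ms b → TCPlus.Inv O k θ P q Y Ch W G β T Z b := by
    intro W G β T Z K S Ps Ms b h
    rcases h.1 with ⟨-, h⟩ | ⟨h, -⟩
    · exact TCPlus.invS₀_inv O k θ P q Y Ch (TCPlus.invS₀L_invS₀ O k θ P q Y Ch h)
    · exact TCPlus.invS_inv O k θ P q Y Ch (TCPlus.invSL_invS O k θ P q Y Ch h)
  -- the plane's side facts through a point blow-up centred on `closure Z` (V10‴ verbatim)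
  have hSstep : ∀ (G₁ G₂ : Scheme.{0}) (υ₁ : G₂ ⟶ G₁) (T Z S : Set G₁) (y : G₁) (hy : IsClosed ({y} : Set G₁)),
      IsLocallyNoetherian G₁ → IsIrreducible T → ¬ T ⊆ closure Z → y ∈ closure Z →
      IsBlowup υ₁ (vanishingIdeal (⟨{y}, hy⟩ : Closeds G₁)) →
      (IsClosed S ∧ S ⊆ closure (S \ closure Z) ∧ ¬ T ⊆ S) →
      (IsClosed (closure (υ₁ ⁻¹' (S \ {y}))) ∧
        closure (υ₁ ⁻¹' (S \ {y})) ⊆ closure (closure (υ₁ ⁻¹' (S \ {y})) \ closure (closure (υ₁ ⁻¹' (Z \ {y})))) ∧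
        ¬ closure (υ₁ ⁻¹' (T \ {y})) ⊆ closure (υ₁ ⁻¹' (S \ {y}))) := by
    intro G₁ G₂ υ₁ T Z S y hy hG₁ hTirr hTZ hyZ hυ₁ ⟨hScl, hSd, hTS⟩
    haveI := hG₁
    have hDsupp : ((vanishingIdeal (⟨{y}, hy⟩ : Closeds G₁) : G₁.IdealSheafData).support : Set G₁) = {y} :=
      Scheme.IdealSheafData.coe_support_vanishingIdeal _
    refine ⟨isClosed_closure, ?_, ?_⟩
    · have h := closure_preimage_diff_subset_of_isBlowup υ₁ _ hυ₁ S (closure Z) isClosed_closure hSd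
      rw [hDsupp] at h
      refine h.trans (closure_mono fun g hg => ⟨hg.1, fun hg' => hg.2 ?_⟩)
      rw [closure_closure] at hg'
      refine closure_mono (Set.preimage_mono ?_) hg'
      intro z hz
      exact ⟨subset_closure hz.1, hz.2⟩
    · have hTy : ¬ T ⊆ {y} := fun h => hTZ (h.trans (Set.singleton_subset_iff.mpr hyZ))
      exact not_closure_preimage_diff_subset hυ₁ hTirr hScl hy hTS hTy hDsupp.le
  -- the plane-LIST bookkeeping through a point blow-up (new plane: a point of `T` off `y` lifts; transported members: as the plane)
  have hLstep : ∀ (G₁ G₂ : Scheme.{0}) (υ₁ : G₂ ⟶ G₁) (T Z : Set G₁) (Ps Ms : List (Set G₁)) (y : G₁) (hy : IsClosed ({y} : Set G₁))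
      (Ps' Ms' : List (Set G₂)),
      IsLocallyNoetherian G₁ → IsIrreducible T → ¬ T ⊆ closure Z → y ∈ closure Z →
      IsBlowup υ₁ (vanishingIdeal (⟨{y}, hy⟩ : Closeds G₁)) →
      (∀ P₀ ∈ Ps, IsClosed P₀ ∧ ¬ T ⊆ P₀) → (∀ M ∈ Ms, IsClosed M ∧ ¬ T ⊆ M) →
      (∀ P' ∈ Ps', P' = υ₁ ⁻¹' {y} ∨ ∃ P₀ ∈ Ps, y ∉ P₀ ∧ P' = closure (υ₁ ⁻¹' (P₀ \ {y}))) →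
      (∀ M' ∈ Ms', ∃ F ∈ Ps ++ Ms, M' = closure (υ₁ ⁻¹' (F \ {y}))) →
      (∀ P' ∈ Ps', IsClosed P' ∧ ¬ closure (υ₁ ⁻¹' (T \ {y})) ⊆ P') ∧
        (∀ M' ∈ Ms', IsClosed M' ∧ ¬ closure (υ₁ ⁻¹' (T \ {y})) ⊆ M') := by
    intro G₁ G₂ υ₁ T Z Ps Ms y hy Ps' Ms' hG₁ hTirr hTZ hyZ hυ₁ hPs hMs hPs' hMs'
    haveI := hG₁
    have hDsupp : ((vanishingIdeal (⟨{y}, hy⟩ : Closeds G₁) : G₁.IdealSheafData).support : Set G₁) = {y} :=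
      Scheme.IdealSheafData.coe_support_vanishingIdeal _
    have hTy : ¬ T ⊆ {y} := fun h => hTZ (h.trans (Set.singleton_subset_iff.mpr hyZ))
    -- the new plane does not contain `St T`: a point of `T` off `y` lifts (isomorphism off the centre)
    have hTnew : ¬ closure (υ₁ ⁻¹' (T \ {y})) ⊆ υ₁ ⁻¹' {y} := by
      obtain ⟨t, htT, htne⟩ := Set.not_subset.mp hTy
      have htJ : t ∉ ((vanishingIdeal (⟨{y}, hy⟩ : Closeds G₁) : G₁.IdealSheafData).support : Set G₁) := by rw [hDsupp]; exact htne
      obtain ⟨t₂, ht₂⟩ := exists_preimage_of_not_mem_support υ₁ _ hυ₁ htJ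
      intro hsub
      have h1 : t₂ ∈ closure (υ₁ ⁻¹' (T \ {y})) := subset_closure (by rw [Set.mem_preimage, ht₂]; exact ⟨htT, htne⟩)
      have h2 := hsub h1
      rw [Set.mem_preimage, ht₂] at h2
      exact htne h2
    have htrans : ∀ F : Set G₁, IsClosed F → ¬ T ⊆ F →
        IsClosed (closure (υ₁ ⁻¹' (F \ {y}))) ∧ ¬ closure (υ₁ ⁻¹' (T \ {y})) ⊆ closure (υ₁ ⁻¹' (F \ {y})) := fun F hF hTF =>
      ⟨isClosed_closure, not_closure_preimage_diff_subset hυ₁ hTirr hF hy hTF hTy hDsupp.le⟩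
    refine ⟨fun P' hP' => ?_, fun M' hM' => ?_⟩
    · rcases hPs' P' hP' with rfl | ⟨P₀, hP₀, -, rfl⟩
      · exact ⟨hy.preimage υ₁.continuous, hTnew⟩
      · exact htrans P₀ (hPs P₀ hP₀).1 (hPs P₀ hP₀).2
    · obtain ⟨F, hF, rfl⟩ := hMs' M' hM'
      rcases List.mem_append.mp hF with hF | hF
      · exact htrans F (hPs F hF).1 (hPs F hF).2
      · exact htrans F (hMs F hF).1 (hMs F hF).2
  -- the point of the reduced carrier lies on `closure Z`
  have hyZof : ∀ (G₁ : Scheme.{0}) (Z : Set G₁) (y : ↥((vanishingIdeal (⟨closure Z, isClosed_closure⟩ : Closeds G₁))).subscheme), (((vanishingIdeal (⟨closure Z, isClosed_closure⟩ : Closeds G₁))).subschemeι y : G₁) ∈ closure Z := by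
    intro G₁ Z y
    have h1 : (((vanishingIdeal (⟨closure Z, isClosed_closure⟩ : Closeds G₁))).subschemeι y : G₁) ∈ Set.range (vanishingIdeal (⟨closure Z, isClosed_closure⟩ : Closeds G₁)).subschemeι := ⟨y, rfl⟩
    rw [Scheme.IdealSheafData.range_subschemeι, Scheme.IdealSheafData.coe_support_vanishingIdeal] at h1
    exact h1
  -- Noetherianity of a stage from the inner invariant (K-slot `∅`)
  have hnoethOf : ∀ W G β T Z K S Ps Ms b, INNER W G β T Z K S Ps Ms b → IsLocallyNoetherian G := fun W G β T Z K S Ps Ms b hI =>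
    hnoethOfINV W β T Z ∅ b (Or.inl ⟨rfl, hINNERinv W G β T Z K S Ps Ms b hI⟩)
  -- the K-side facts through a point blow-up in the KCL arm (V10‴ verbatim)
  have hKstep : ∀ (G₁ G₂ : Scheme.{0}) (υ₁ : G₂ ⟶ G₁) (T Z K : Set G₁) (y : G₁) (hy : IsClosed ({y} : Set G₁)),
      IsLocallyNoetherian G₁ → IsIntegral G₁ → ¬ T ⊆ closure Z → y ∈ closure Z → IsBlowup υ₁ (vanishingIdeal (⟨{y}, hy⟩ : Closeds G₁)) →
      IsClosed K → K ⊆ closure (K \ closure Z) → K ≠ Set.univ →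
      (IsClosed (closure (υ₁ ⁻¹' (K \ {y}))) ∧
        closure (υ₁ ⁻¹' (K \ {y})) ⊆ closure (closure (υ₁ ⁻¹' (K \ {y})) \ closure (closure (υ₁ ⁻¹' (Z \ {y})))) ∧
        closure (υ₁ ⁻¹' (K \ {y})) ≠ Set.univ) := by
    intro G₁ G₂ υ₁ T Z K y hy hG₁ hG₁int hTZ hyZ hυ₁ hKcl hKd hKne
    haveI := hG₁
    haveI := hG₁int
    refine ⟨isClosed_closure, ?_, ?_⟩
    · have h := closure_preimage_diff_subset_of_isBlowup υ₁ _ hυ₁ K (closure Z) isClosed_closure hKd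
      rw [Scheme.IdealSheafData.coe_support_vanishingIdeal] at h
      refine h.trans (closure_mono fun g hg => ⟨hg.1, fun hg' => hg.2 ?_⟩)
      rw [closure_closure] at hg'
      refine closure_mono (Set.preimage_mono ?_) hg'
      intro z hz
      exact ⟨subset_closure hz.1, hz.2⟩
    · exact closure_preimage_ne_univ υ₁ _ hυ₁ K {y} hKcl hKne hy
        (fun h => hTZ (fun z _ => by rw [Set.eq_univ_iff_forall] at h; rw [Set.mem_singleton_iff.mp (h z)]; exact hyZ))
        (by rw [Scheme.IdealSheafData.coe_support_vanishingIdeal]; rfl) _ (Set.preimage_mono fun z hz => hz.1)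
  refine hsub_reachTowerBQuadPrime_of_fact k O θ hθ P q Y Ch hChStep hChSplit hYsp hYirr hYcl hPint hPnoeth hPreg hqprop hqsm υ x T₁ Ls₂ hFact INNER
    hINNERinv ?_ ?_ ?_ ?_
  · -- ===================== (base) =====================
    intro W K₂ hxW hnot hWpr hK₂
    have hZcl : IsClosed (υ ⁻¹' {x} ∩ closure (υ ⁻¹' (W \ {x}))) := hEx.inter isClosed_closure
    have hSF : IsClosed (υ ⁻¹' ({x} : Set F₁)) ∧
        υ ⁻¹' {x} ⊆ closure (υ ⁻¹' {x} \ closure (υ ⁻¹' {x} ∩ closure (υ ⁻¹' (W \ {x})))) ∧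
        ¬ closure (υ ⁻¹' (T₁ \ {x})) ⊆ υ ⁻¹' {x} := by
      refine ⟨hEx, ?_, fun h => hy₀.2 (h (subset_closure hy₀))⟩
      rw [hZcl.closure_eq]
      have h1 : (υ ⁻¹' ({x} : Set F₁) ∩ (closure (υ ⁻¹' (W \ {x})))ᶜ).Nonempty := by
        by_contra h0
        apply hnot
        intro e he
        by_contra he'
        exact h0 ⟨e, he, he'⟩
      refine (subset_closure_inter_of_isPreirreducible_of_isOpen hExirr.isPreirreducible isClosed_closure.isOpen_compl h1).trans
        (closure_mono fun e he => ⟨he.1, fun h => he.2 h.2⟩)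
    have hnil : (∀ P₀ ∈ Ls₂, IsClosed P₀ ∧ ¬ closure (υ ⁻¹' (T₁ \ {x})) ⊆ P₀) ∧
        (∀ M ∈ ([] : List (Set F₂)), IsClosed M ∧ ¬ closure (υ ⁻¹' (T₁ \ {x})) ⊆ M) :=
      ⟨hLs₂, fun M hM => by simp at hM⟩
    rcases hK₂ with rfl | ⟨hcone, rfl⟩
    · exact ⟨Or.inl ⟨rfl, hBaseS₀L W hxW hnot hWpr⟩, hnil.1, hnil.2, hSF⟩
    · refine ⟨Or.inr ⟨hBaseSL W hxW hnot hWpr hcone, isClosed_closure, ?_, ?_, hZcl⟩, hnil.1, hnil.2, hSF⟩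
      · have hZcl' : closure (υ ⁻¹' {x} ∩ closure (υ ⁻¹' (W \ {x}))) ⊆ υ ⁻¹' {x} :=
          closure_minimal Set.inter_subset_left hEx
        exact closure_minimal (fun g hg => subset_closure ⟨subset_closure hg, fun h => hg.2 (hZcl' h)⟩) isClosed_closure
      · intro huniv
        apply hnot
        rw [huniv]; exact Set.subset_univ _
  · -- ===================== (step, flag kept) =====================
    intro W G₁ G₂ β T Z K S Ps Ms b y υ₁ hy Ps' Ms' hI hyT hyreg' hyreg hυ₁ hPs' hMs'
    have hinv := hINNERinv _ _ _ _ _ _ _ _ _ _ hI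
    obtain ⟨hG₁, -, hTirr, hTZ, -⟩ := hinv
    haveI := hG₁
    haveI : IsLocallyNoetherian G₁ := hnoethOf _ _ _ _ _ _ _ _ _ _ hI
    have hyZ := hyZof G₁ Z y
    obtain ⟨hI1, hPs, hMs, hS⟩ := hI
    obtain ⟨hPs'B, hMs'B⟩ := hLstep G₁ G₂ υ₁ T Z Ps Ms _ hy Ps' Ms' inferInstance hTirr hTZ hyZ hυ₁ hPs hMs hPs' hMs'
    refine ⟨?_, hPs'B, hMs'B, hSstep G₁ G₂ υ₁ T Z S _ hy inferInstance hTirr hTZ hyZ hυ₁ hS⟩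
    have hPcl : ∀ P₀ ∈ Ps, IsClosed P₀ := fun P₀ hP => (hPs P₀ hP).1
    rcases hI1 with ⟨rfl, hI₀⟩ | ⟨hIS, hKcl, hKd, hKne, hZcl⟩
    · refine Or.inl ⟨by simp, ?_⟩
      exact (invS₀L_step_regular O k θ hθ P q Y hYsp hYirr hYcl hPnoeth hPreg Ch hChSplit hChStep W G₁ G₂ β T Z S Ps b y υ₁ hy hI₀ hPcl hyT
        hyreg' hyreg hυ₁ Ps' hPs').2
    · have hI₂ := invSL_step_regular O k θ hθ P q Y hYsp hYirr hYcl hPnoeth hPreg Ch hChSplit hChStep W G₁ G₂ β T Z K S Ps b y υ₁ hy hIS hPcl hZcl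
        hyT hyreg' hyreg hυ₁ Ps' hPs'
      obtain ⟨hK1, hK2, hK3⟩ := hKstep G₁ G₂ υ₁ T Z K _ hy inferInstance hG₁ hTZ hyZ hυ₁ hKcl hKd hKne
      exact Or.inr ⟨hI₂.2, hK1, hK2, hK3, isClosed_closure⟩
  · -- ===================== (step, flag raised) =====================
    intro W G₁ G₂ β T Z K S Ps Ms y υ₁ hy Ps' Ms' hI hyT hysing hyreg hυ₁ hPs' hMs'
    have hinv := hINNERinv _ _ _ _ _ _ _ _ _ _ hI
    obtain ⟨hG₁, -, hTirr, hTZ, -⟩ := hinv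
    haveI := hG₁
    haveI : IsLocallyNoetherian G₁ := hnoethOf _ _ _ _ _ _ _ _ _ _ hI
    have hyZ := hyZof G₁ Z y
    obtain ⟨hI1, hPs, hMs, hS⟩ := hI
    obtain ⟨hPs'B, hMs'B⟩ := hLstep G₁ G₂ υ₁ T Z Ps Ms _ hy Ps' Ms' inferInstance hTirr hTZ hyZ hυ₁ hPs hMs hPs' hMs'
    refine ⟨?_, hPs'B, hMs'B, hSstep G₁ G₂ υ₁ T Z S _ hy inferInstance hTirr hTZ hyZ hυ₁ hS⟩
    have hPcl : ∀ P₀ ∈ Ps, IsClosed P₀ := fun P₀ hP => (hPs P₀ hP).1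
    rcases hI1 with ⟨rfl, hI₀⟩ | ⟨hIS, hKcl, hKd, hKne, hZcl⟩
    · refine Or.inl ⟨by simp, ?_⟩
      exact (invS₀L_step_singular O k θ hθ P q Y hYsp hYirr hYcl hPnoeth hPreg Ch hChSplit hChStep W G₁ G₂ β T Z S Ps y υ₁ hy hI₀ hPcl hyT
        hysing hyreg hυ₁ Ps' hPs').2
    · have hI₂ := invSL_step_singular O k θ hθ P q Y hYsp hYirr hYcl hPnoeth hPreg Ch hChSplit hChStep W G₁ G₂ β T Z K S Ps y υ₁ hy hIS hPcl hZcl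
        hyT hysing hyreg hυ₁ Ps' hPs'
      obtain ⟨hK1, hK2, hK3⟩ := hKstep G₁ G₂ υ₁ T Z K _ hy inferInstance hG₁ hTZ hyZ hυ₁ hKcl hKd hKne
      exact Or.inr ⟨hI₂.2, hK1, hK2, hK3, isClosed_closure⟩
  · -- ===================== (curve) =====================
    intro W F₉ β₉ T₉ Z₉ K₉ S₉ Ps₉ Ms₉ b₉ hZ₉ F₁₀ υ' Es₁₀ Ns₁₀ hI hZ₉T₉ hT₉Z₉ hZinf hυ' hEs hNs
    have hinv := hINNERinv _ _ _ _ _ _ _ _ _ _ hI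
    obtain ⟨hG₉, -⟩ := hinv
    haveI := hG₉
    haveI : IsLocallyNoetherian F₉ := hnoethOf _ _ _ _ _ _ _ _ _ _ hI
    obtain ⟨hI1, hPs, hMs, hS₉cl, hS₉d, hTS₉⟩ := hI
    have hS₉dense : S₉ ⊆ closure (S₉ \ Z₉) := by rw [← hZ₉.closure_eq]; exact hS₉d
    have hZsupp : ((vanishingIdeal (⟨Z₉, hZ₉⟩ : Closeds F₉) : F₉.IdealSheafData).support : Set F₉) = Z₉ :=
      Scheme.IdealSheafData.coe_support_vanishingIdeal _
    rcases hI1 with ⟨rfl, hI₀⟩ | ⟨hIS, hKcl, hKd, hKne, -⟩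
    · have h := Tower.invB₄_of_invS₀L_curveStep_forget_FE O k θ hθ P q Y hYsp hYirr hYcl hPnoeth hPreg Ch hChSplit hChStep W F₉ β₉ T₉ Z₉ ∅ S₉ Ps₉ Ms₉
        b₉ hZ₉ F₁₀ υ' hI₀ hPs hMs hZinf rfl hS₉cl hS₉dense hTS₉ hZ₉T₉ hT₉Z₉ hυ' Es₁₀ Ns₁₀ hEs hNs
      have h0 : closure (υ' ⁻¹' ((∅ : Set F₉) \ Z₉)) = ∅ := by simp
      rw [h0] at h ⊢
      haveI : IsIntegral F₁₀ := h.2.2.1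
      exact ⟨h, isClosed_empty, by simp, Set.empty_ne_univ⟩
    · have hKdense : K₉ ⊆ closure (K₉ \ Z₉) := hKd.trans (closure_mono fun z hz => ⟨hz.1, fun h => hz.2 (subset_closure h)⟩)
      have h := Tower.invB₄_of_invSL_curveStep_FE O k θ hθ P q Y hYsp hYirr hYcl hPnoeth hPreg Ch hChSplit hChStep W F₉ β₉ T₉ Z₉ K₉ S₉ Ps₉ Ms₉ b₉
        hZ₉ F₁₀ υ' hIS hPs hMs hZinf hKcl hKne hKdense hS₉cl hS₉dense hTS₉ hZ₉T₉ hT₉Z₉ hυ' Es₁₀ Ns₁₀ hEs hNs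
      refine ⟨h, isClosed_closure, ?_, ?_⟩
      · exact closure_preimage_diff_subset_closure_diff_preimage υ' K₉ Z₉
      · obtain ⟨-, -, -, hTcl, hTirr, -⟩ := h
        exact closure_preimage_ne_univ υ' _ hυ' K₉ Z₉ hKcl hKne hZ₉ (fun h => hT₉Z₉ (h ▸ Set.subset_univ _)) hZsupp.le _
          (Set.preimage_mono fun z hz => hz.1)

end Summit.ResolutionOfSingularities.ResolutionOfSingularities.Cruxes.EquisingularLiftNat.Sections

end
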